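import Literature.Probability.FitznerVanDerHofstad2017.NobleSymmetry
import Literature.Probability.FitznerVanDerHofstad2017.NobleRelationSummed
import Literature.Barriers.CriticalPhenomena.LaceExpansionNobleContinuitySummed
import HarnessLib

/-!
# The remainder bounds of the percolation NoBLE: [FitznerVanDerHofstad2017] (3.35) and Prop. 2.1 (2.19)–(2.20)

R. Fitzner, R. van der Hofstad, *Mean-field behavior for nearest-neighbor percolation in d > 10*,
Electron. J. Probab. **22** (2017) no. 43, arXiv:1506.07977v2 (equation numbers and pages below are those of
arXiv v2; the EJP version shares the equation counter).  This module PROVES, from the tree's typed NoBLE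
coefficients (`Literature.Barriers.CriticalPhenomena.LaceExpansionNobleCoefficients`: `nobleOp`, `nobleIter`,
`nobleXiBT`/`noblePsiBT`/`nobleRBT` = `Ξ^{B,(N)}`, `Ψ^{B,(N),κ}`, `|R^B_N|` of (3.31)–(3.33), and the completed
`noblePsiT`/`noblePsiN`/`nobleR`, `noblePiT`/`noblePiN`/`nobleRIotaT`/`nobleRIota` of §3.3), the two remainder
bounds of the non-backtracking lace expansion.  Nothing is cited as a hypothesis: every `[cite:]` tag is
provenance.

## The printed statements (verbatim, TeX source of arXiv:1506.07977v2)

* (3.34)–(3.35), p. 27 (§3.2, after the definitions (3.31)–(3.33) of `Ξ^{B,(N)}`, `Ψ^{B,(N),κ}`, `R^B_N`):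
  "Since `P^{b̲_N}_{N+1}(b̄_N ↔^{C̃_N} y) ≤ τ^{b̲_N}(b̄_N, x)`, it follows from (3.32)–(3.33) that
  `|R^B_N(x,y;A)| ≤ Σ_{w,κ} Ψ^{B,(N),κ}(x,w;A) p τ^κ(y − w + e_κ)`."  (3.35) [TeX label `Rxbd`]
* after (3.37), pp. 27–28: "Naturally, the convergence of the expansion needs to be obtained to reach the above
  conclusion. This convergence follows from (3.35) and the bounds on `Ψ^{B,(N),κ}` that we prove in Section 4,
  by showing that the remainder term `R^B_N` converges to zero."
* Proposition 2.1 (Non-backtracking lace expansion), pp. 10–11 (heading and (2.14)–(2.15) on p. 10, (2.16)–(2.20)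
  on p. 11; TeX l.1206–1242; the same display, with the same equation numbers, is on EJP 22 (2017) no. 43 p. 10): "For every `x ∈ ℤ^d`, `ι, κ ∈ {±1, ±2, …, ±d}`, and
  `M ≥ 1`, the following recursion relations hold: … (2.14)–(2.17) …
  `μ_p = p P(e₁ ∉ C(0) | (0, e₁) vacant)`, (2.18) [TeX label `Definition-aap`; the macro is `\aap`,
  `\def\aap{\mu_p}` at TeX l.528]
  with
  `R_M(x) ≤ μ_p Σ_{y ∈ ℤ^d, κ ∈ {±1,…,±d}} Ψ^{(M),κ}(y) τ^κ(x − y + e_κ)`, (2.19) [TeX label `RM-bd`, l.1237: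
  `R_{\sss M}(x) \leq \aap \sum … \Psi^{\ssc[M],\kappa}(y) \tau^{\kappa}(x-y+\ve[\kappa])`]
  `R^ι_M(x) ≤ Σ_{y ∈ ℤ^d, κ ∈ {±1,…,±d}} Π^{(M),ι,κ}(y) τ^κ(x − y + e_κ)`. (2.20) [TeX label `RMiota-bd`, l.1238]"
  NOTE ON VERSIONS: the prefactor `μ_p` in (2.19) is printed in arXiv v2 and in the EJP version; the FIRST arXiv
  version (1506.07977v1, `IntroOv.tex` l.244) displays (2.19) WITHOUT it,
  `R_M(x) ≤ Σ_{y,κ} Ψ^{(M),κ}(y) τ^κ(x − y + e_κ)` — a weaker statement, implied by the printed one since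
  `μ_p ≤ 1`.  Below, "as printed" always means the v2 = EJP form with `μ_p`.
* end of §3.3, p. 30 (after (3.55)–(3.57)): "Finally, (3.35) together with the above characterization of
  `R_M(x)` and `R^ι_M(x)` proves (2.19)–(2.20)."

## What is proved here

* `nobleRBT_succ_le` — (3.35) for `N ≥ 1` and ARBITRARY outer data `(B, A′)`, in `[0,∞]`:
  `nobleRBT B A′ (N+1) A x y ≤ Σ'_u Σ_κ p · noblePsiBT B A′ e_κ (N+1) A x u · τ^{e_κ}(y − u + e_κ)`;
  `nobleRBT_zero_le` — (3.35) at `N = 0` under the side condition that no cell uses a bond of `B`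
  (see TYPING READING (b)); `nobleRBT_empty_le` (data `(∅, A′)`, all `N`) and `nobleRBT_bondsAt_le`
  (data `(B(w), A′ ∋ w)`, start `x ∉ A`, all `N`) discharge it for the two outer data of §3.3.
* `nobleRBT_remainder_le_noblePsiT`, `abs_nobleR_le_mu`, `abs_nobleR_le`, `abs_nobleR_le_tsum_noblePsiN` —
  (2.19) for `M ≥ 1`: in `[0,∞]` for every `p`, and over `ℝ` for `d ≥ 2`, `0 < p < p_c` (where all the sums
  are finite, `LaceExpansionNobleContinuitySummed`), in the PRINTED form (arXiv v2 = EJP, with the prefactor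
  `μ_p` of (2.18)) `|R_M(x)| ≤ μ_p Σ_y Σ_κ Ψ^{(M),κ}(y) τ^κ(x−y+e_κ)` (`abs_nobleR_le_mu`), in the weaker
  `μ_p`-free form of the arXiv v1 display (`abs_nobleR_le`, a corollary via `μ_p ≤ 1`), and in the form
  `|R_M(x)| ≤ Σ_y Σ_κ Ψ^{(M),κ}(y)` (`τ^κ ≤ 1`) from which `R_M → 0` is read off the summability of
  `Σ_N Σ_y Ψ^{(N),κ}`.
* `nobleRIotaT_succ_le`, `abs_nobleRIota_le`, `abs_nobleRIota_le_tsum_noblePiN` — (2.20) for `M ≥ 1`, in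
  `[0,∞]` for every `p` and over `ℝ` for `d ≥ 2`, `p < p_c`.
* The toolkit this needs and that the finite-`M` identities of Lemma 3.3 / Prop. 2.1 will need again:
  measurability of the NoBLE cells, integrands, kernels and iterates in the set variable
  (`NobleKernelMeasurable`, `nobleOp_measurable`, `nobleIter_measurable`, `nobleKer{Xi,Psi,Through}_measurable`,
  `noble{Xi,Psi,R}BT_measurable`); σ-additivity of the nesting operator and of the `𝔼_0^{b_ι}`-correction
  (`nobleOp_tsum_mul`, `nobleIter_tsum_mul`, `nobleIotaCorr_tsum_mul` — monotone convergence + Tonelli);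
  dependence on the last argument only through the kernel (`nobleOp_congr_last`, `nobleIter_congr_last`),
  `𝒩ⁿ⁺¹h = 𝒩ⁿ(𝒩h)` (`nobleIter_succ'`); the bond sum as a sum over the `2d` directions (`tsum_bondJ_mul`);
  translation invariance `P^{B(u)}(u′ ↔ y) = τ^{(u−u′)}(y − u′)` (`probOff_bondsAt_openConn_shift`, via the
  hφ-free transport lemmas of `NobleSymmetry` applied to the shift isomorphism `zdShiftIso`).

## Proof (as in the paper, made explicit)

The innermost kernel of `R^B_N` is `P^{B(u)}(u′ ↔ y through C̃ ∪ A′) ≤ P^{B(u)}(u′ ↔ y)` ((3.34); a constant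
on the cell), and `P^{B(u)}(u − e ↔ y) = τ^{e}(y − u + e)` by translation; with `J(u′ − u) = p𝟙{u′ = u − e_κ}`
the innermost expectation is `≤ Σ_u Σ_κ p · P(cell(u, u − e_κ)) · τ^{e_κ}(y − u + e_κ)`
(`nobleOp_nobleKerThrough_le`).  For an inner level the cell probability IS the kernel `nobleKerPsi e_κ`
(`measure_nobleCell_inner`), so `𝒩_{w′}[P^{B(·)}(· ↔ y′ through ·)] ≤ K(·,y′)` with
`K = Σ_{(u,κ)} p τ^{e_κ}(y′ − u + e_κ) · nobleKerPsi e_κ (·, u)`; monotonicity of the remaining `N` nesting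
operators (`nobleIter_mono`, `nobleOp_mono`), the observation that they see the final point only through the
kernel (so the coefficients may be frozen at `y′ = y`), and σ-additivity give
`|R^B_{N+1}|(x,y;A) ≤ Σ_{(u,κ)} p τ^{e_κ}(y − u + e_κ) · 𝒩^{B,A′}𝒩^{N}[nobleKerPsi e_κ](A,x,u)
 = Σ_u Σ_κ p Ψ^{B,(N+1),κ}(x,u;A) τ^κ(y − u + e_κ)`.
For (2.19): `R_M = R^∅_M(0,·;{0})` (3.44) and `p Ψ^{∅,(M),κ}(0,y;{0}) = μ_p Ψ^{(M),κ}(y)` (3.43) for `M ≥ 1`.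
For (2.20): (3.57) writes `R^ι_M` as `R^{b_ι}_M(0,x;{e_ι})` plus `p 𝔼_0^{b_ι}[𝟙{e_ι ∉ C̃} R^{B(0)}_{M−1}(e_ι,x;C̃)]`;
(3.35) bounds the first by `Σ p Ψ^{b_ι,(M),κ} τ^κ` and the integrand of the second by
`Σ p Ψ^{B(0),(M−1),κ}(e_ι,·;C̃) τ^κ` on `{e_ι ∉ C̃}`; exchanging `𝔼_0^{b_ι}` with the sum (σ-additivity of the
correction functional, which needs the measurability of `C ↦ Ψ^{B(0),(M−1),κ}(e_ι,y;C)`) and collecting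
with (3.56) gives `Σ_y Σ_κ Π^{(M),ι,κ}(y) τ^κ(x − y + e_κ)`.

## Typing readings (where the Lean statement is more explicit than the print)

(a) `M ≥ 1`, as printed in Prop. 2.1.  At `M = 0` the printed right side of (2.19) misses the term `y = 0`:
`Ψ^{(0),κ}(0) = 0` by the factor `(1 − δ_{0,y})` of (3.42), whereas `Ψ^{∅,(0),κ}(0,0;{0}) = P(−e_κ ∉
C̃^{(0,−e_κ)}(0)) = μ_p/p ≠ 0` does contribute to (3.35); the `[0,∞]` statements `nobleRBT_empty_le` /
`nobleRBT_bondsAt_le` cover `N = 0` with the un-normalised `Ψ^{B,(0),κ}`.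
(b) The cell of a level, `{E′(v,u;A) off B} ∩ {u′ ∉ C̃^{(u,u′)}(v) ∪ A′}`, does not know whether its bond
`(u,u′)` lies in `B`, while the typed `Ψ^{B,(0),κ}` (3.32)/(3.28) carries `𝟙{(y, y−e_κ) ∉ B}` (the bond
sum of Lemma 3.3 is over `b ∉ B`).  For `N ≥ 1` the last cell has outer data `(B(w′),{w′})` and is exactly
the event of `nobleKerPsi` (no discrepancy); at `N = 0` we assume that cells on bonds of `B` are empty (`hB`),
which holds for `B = ∅` trivially and for `(B(w), A′ ∋ w)` with a start `x ∉ A` because `w` is isolated in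
`ω_{B(w)^c}` (`nobleCell_bondsAt_eq_empty`) — the data `(B(0),{0})`, `x = e_ι ∉ C̃` of (3.57).
(c) The factor `μ_p`: (3.35) carries `p Ψ^{∅,(M),κ}(0,y;{0}) = μ_p Ψ^{(M),κ}(y)` ((3.43):
`Ψ^{(N),κ} = (p/μ_p) Ψ^{∅,(N),κ}(0,·;{0})`), which is exactly the printed (2.19) with its prefactor `μ_p`
(`abs_nobleR_le_mu`); since `μ_p ≤ p ≤ 1` (`nobleMu_le_one`) the `μ_p`-free display of arXiv v1 follows
(`abs_nobleR_le`).  The tree's `nobleMu d p` (`GaussianDominationRouteNoble.nobleMu`) is BY DEFINITION the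
`μ_p` of (2.18) = the TeX macro `\aap`: `p · P_p(e₁ ∉ C(0) | (0,e₁) vacant)` (Mathlib `cond`); (3.42) writes the
same number as `p · P(e ∉ C̃^{(0,e)}(0))` because on `{(0,e₁) vacant}` the cluster `C(0)` is the off-bond
cluster `C̃^{(0,e₁)}(0)` and the bond `(0,e₁)` is independent of the rest.  `0 < p` is assumed so that `μ_p > 0`
(`nobleMu_pos`; at `p = 0` both sides vanish).
(d) Sign: `R_M`, `R^ι_M` are real with sign `(−1)^{M+1}` (3.33) (and the derivation's sign of the second
summand of (3.57), see `nobleRIota`); the bounds are stated for `|R_M|`, `|R^ι_M|`, which is how (2.19)–(2.20)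
are used ((2.19)–(2.20) bound `R_M ≤ …`; `R ≤ |R|`).
(e) Finiteness: over `ℝ` the statements assume `d ≥ 2` and `p < p_c`, where every coefficient and every
`y`-sum is finite (`noblePsiBT_ne_top`, `tsum_nobleMaj_sub_ne_top`, `summable_weighted_noblePsiT_toReal`,
`summable_weighted_noblePiN` of the Continuity modules); the `[0,∞]` statements need nothing.
-/

noncomputable section

namespace Literature.Probability.FitznerVanDerHofstad2017

open _root_.MeasureTheory Literature.Barriers.CriticalPhenomena Literature.Probability.Percolation
open Literature.Probability.LatticeModels
open scoped BigOperators ENNReal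

variable {d : ℕ}

/-! ### A. Measurability of the NoBLE cells, integrands, kernels and iterates

(`measurable_offBonds`, `measurableSet_nobleCell` are those of `LaceExpansionNobleContinuity`; here we add
the JOINT measurability in `(A, ω)` that Fubini/Tonelli for `A ↦ 𝒩h(A, v, x)` needs.) -/

/-- A NoBLE kernel `h(w, A, v, x)` is *measurable* if it is measurable in the set variable `A` (the
random set `C̃_j` of the enclosing expectation). [cite: FitznerVanDerHofstad2017, (3.31)–(3.33) (arXiv:1506.07977v2 p. 27: "C̃ … deterministic when it appears in events described by P₁")] -/
def NobleKernelMeasurable (h : NobleKernel d) : Prop :=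
  ∀ w v x : Site d, Measurable fun A : Set (Site d) => h w A v x

/-- `z ↦ S(z) ∪ A′` is measurable when `S` is. [folklore] -/
theorem measurable_union_const {X : Type*} [MeasurableSpace X] {S : X → Set (Site d)} (hS : Measurable S)
    (A' : Set (Site d)) : Measurable fun z => S z ∪ A' := by
  refine measurable_set_iff.2 fun a => ?_
  simp only [Set.mem_union]
  exact (measurable_set_iff.1 hS a).or measurable_const

/-- `ω ↦ C̃^{(u,u′)}(v)(ω_{B^c}) ∪ A′` is a measurable map into sets.
[cite: FitznerVanDerHofstad2017, (3.26) (arXiv:1506.07977v2 p. 26)] -/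
theorem measurable_restrCluster_offBonds (B : Set (Sym2 (Site d))) (A' : Set (Site d)) (u u' v : Site d) :
    Measurable fun ω => restrCluster u u' v (offBonds B ω) ∪ A' :=
  measurable_union_const ((measurable_restrCluster u u' v).comp (measurable_offBonds B)) A'

/-- The cell event of one NoBLE level is jointly measurable in `(A, ω)`.
[cite: FitznerVanDerHofstad2017, (3.31) (arXiv:1506.07977v2 p. 27)] -/
theorem measurableSet_nobleCell_prod (B : Set (Sym2 (Site d))) (A' : Set (Site d)) (v u u' : Site d) :
    MeasurableSet {q : Set (Site d) × BondConfig (Site d) | q.2 ∈ nobleCell B A' q.1 v u u'} := by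
  have h1 : MeasurableSet {q : Set (Site d) × BondConfig (Site d) | offBonds B q.2 ∈ laceE q.1 v u} :=
    measurableSet_laceE_comp measurable_fst ((measurable_offBonds B).comp measurable_snd) v u
  have h2 : MeasurableSet {q : Set (Site d) × BondConfig (Site d) |
      u' ∈ restrCluster u u' v (offBonds B q.2) ∪ A'} :=
    measurableSet_setOf.2
      (measurable_set_iff.1 ((measurable_restrCluster_offBonds B A' u u' v).comp measurable_snd) u')
  have e : {q : Set (Site d) × BondConfig (Site d) | q.2 ∈ nobleCell B A' q.1 v u u'} =
      {q | offBonds B q.2 ∈ laceE q.1 v u} ∩ {q | u' ∈ restrCluster u u' v (offBonds B q.2) ∪ A'}ᶜ := by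
    ext q
    simp only [Set.mem_setOf_eq, mem_nobleCell_iff, Set.mem_inter_iff, Set.mem_compl_iff]
  rw [e]
  exact h1.inter h2.compl

/-- The integrand of the NoBLE nesting operator is jointly measurable in `(A, ω)` for a measurable
kernel. [cite: FitznerVanDerHofstad2017, (3.26), (3.31)–(3.33) (arXiv:1506.07977v2 pp. 26–27)] -/
theorem measurable_nobleIntegrand_prod {h : NobleKernel d} (hh : NobleKernelMeasurable h)
    (B : Set (Sym2 (Site d))) (A' : Set (Site d)) (v x u u' : Site d) :
    Measurable fun q : Set (Site d) × BondConfig (Site d) =>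
      (nobleCell B A' q.1 v u u').indicator (fun ω => h u (restrCluster u u' v (offBonds B ω) ∪ A') u' x) q.2 := by
  have hF : Measurable fun q : Set (Site d) × BondConfig (Site d) =>
      ({q' : Set (Site d) × BondConfig (Site d) | q'.2 ∈ nobleCell B A' q'.1 v u u'}).indicator
        (fun q' => h u (restrCluster u u' v (offBonds B q'.2) ∪ A') u' x) q :=
    ((hh u u' x).comp ((measurable_restrCluster_offBonds B A' u u' v).comp measurable_snd)).indicator
      (measurableSet_nobleCell_prod B A' v u u')
  exact hF

/-- The integrand of the NoBLE nesting operator is measurable in `ω` (fixed `A`).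
[cite: FitznerVanDerHofstad2017, (3.26), (3.31)–(3.33) (arXiv:1506.07977v2 pp. 26–27)] -/
theorem measurable_nobleIntegrand {h : NobleKernel d} (hh : NobleKernelMeasurable h)
    (B : Set (Sym2 (Site d))) (A' A : Set (Site d)) (v x u u' : Site d) :
    Measurable fun ω => (nobleCell B A' A v u u').indicator
      (fun ω => h u (restrCluster u u' v (offBonds B ω) ∪ A') u' x) ω :=
  ((hh u u' x).comp (measurable_restrCluster_offBonds B A' u u' v)).indicator
    (measurableSet_nobleCell B A' A v u u')

/-- **The NoBLE nesting operator preserves measurability** (Fubini measurability of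
`A ↦ Σ_b J 𝔼[𝟙_{cell} h(C̃ ∪ A′, …)]`). [cite: FitznerVanDerHofstad2017, (3.26), (3.31) (arXiv:1506.07977v2 pp. 26–27)] -/
theorem nobleOp_measurable (p : unitInterval) (B : Set (Sym2 (Site d))) (A' : Set (Site d)) {h : NobleKernel d}
    (hh : NobleKernelMeasurable h) (v x : Site d) : Measurable fun A => nobleOp d p B A' h A v x := by
  refine Measurable.tsum fun b => Measurable.const_mul ?_ _
  exact (measurable_nobleIntegrand_prod hh B A' v x b.1 b.2).lintegral_prod_right'

/-- The inner-level operator preserves measurability. [cite: FitznerVanDerHofstad2017, (3.26), (3.31) (arXiv:1506.07977v2 pp. 26–27)] -/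
theorem nobleOpW_measurable (p : unitInterval) {h : NobleKernel d} (hh : NobleKernelMeasurable h) :
    NobleKernelMeasurable (nobleOpW d p h) := fun w v x =>
  nobleOp_measurable p (bondsAt {w}) {w} hh v x

/-- All iterates of a measurable kernel are measurable. [cite: FitznerVanDerHofstad2017, (3.31)–(3.33) (arXiv:1506.07977v2 p. 27)] -/
theorem nobleIter_measurable (p : unitInterval) {h : NobleKernel d} (hh : NobleKernelMeasurable h) :
    ∀ n, NobleKernelMeasurable (nobleIter d p h n)
  | 0 => hh
  | n + 1 => nobleOpW_measurable p (nobleIter_measurable p hh n)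

/-- `nobleKerXi` is measurable: `A ↦ P^{B(w)}(E′(v,x;A))`. [cite: FitznerVanDerHofstad2017, (3.31) (arXiv:1506.07977v2 p. 27)] -/
theorem nobleKerXi_measurable (p : unitInterval) : NobleKernelMeasurable (nobleKerXi d p) := fun w v x =>
  measurable_measure_prodMk_left
    (measurableSet_laceE_comp measurable_fst ((measurable_offBonds (bondsAt {w})).comp measurable_snd) v x)

/-- `nobleKerThrough` is measurable: `A ↦ P^{B(w)}(v ↔ x through A)`. [cite: FitznerVanDerHofstad2017, (3.33) (arXiv:1506.07977v2 p. 27)] -/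
theorem nobleKerThrough_measurable (p : unitInterval) : NobleKernelMeasurable (nobleKerThrough d p) :=
  fun w v x => measurable_measure_prodMk_left
    (measurableSet_connThrough_comp measurable_fst ((measurable_offBonds (bondsAt {w})).comp measurable_snd) v x)

/-- `nobleKerPsi` is measurable: `A ↦ P^{B(w)}(E′(v,x;A) ∩ {x - e ∉ C̃^{(x,x-e)}(v) ∪ {w}})`.
[cite: FitznerVanDerHofstad2017, (3.32) (arXiv:1506.07977v2 p. 27)] -/
theorem nobleKerPsi_measurable (p : unitInterval) (e : Site d) : NobleKernelMeasurable (nobleKerPsi d p e) := by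
  intro w v x
  have h1 : MeasurableSet {q : Set (Site d) × BondConfig (Site d) | offBonds (bondsAt {w}) q.2 ∈ laceE q.1 v x} :=
    measurableSet_laceE_comp measurable_fst ((measurable_offBonds (bondsAt {w})).comp measurable_snd) v x
  have h2 : MeasurableSet {q : Set (Site d) × BondConfig (Site d) |
      x - e ∈ restrCluster x (x - e) v (offBonds (bondsAt {w}) q.2) ∪ {w}} :=
    measurableSet_setOf.2 (measurable_set_iff.1
      ((measurable_restrCluster_offBonds (bondsAt {w}) {w} x (x - e) v).comp measurable_snd) (x - e))
  have hS : MeasurableSet {q : Set (Site d) × BondConfig (Site d) | offBonds (bondsAt {w}) q.2 ∈ laceE q.1 v x ∧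
      x - e ∉ restrCluster x (x - e) v (offBonds (bondsAt {w}) q.2) ∪ {w}} := by
    have e' : {q : Set (Site d) × BondConfig (Site d) | offBonds (bondsAt {w}) q.2 ∈ laceE q.1 v x ∧
        x - e ∉ restrCluster x (x - e) v (offBonds (bondsAt {w}) q.2) ∪ {w}} =
        {q | offBonds (bondsAt {w}) q.2 ∈ laceE q.1 v x} ∩
          {q | x - e ∈ restrCluster x (x - e) v (offBonds (bondsAt {w}) q.2) ∪ {w}}ᶜ := by
      ext q; simp only [Set.mem_setOf_eq, Set.mem_inter_iff, Set.mem_compl_iff]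
    rw [e']; exact h1.inter h2.compl
  exact measurable_measure_prodMk_left hS

/-! ### B. σ-additivity of the nesting operator and dependence on the last argument only through the kernel -/

/-- Indicators commute with countable non-negative combinations. [folklore] -/
theorem indicator_tsum_mul {α ι : Type*} (S : Set α) (c : ι → ℝ≥0∞) (f : ι → α → ℝ≥0∞) (a : α) :
    S.indicator (fun a => ∑' i, c i * f i a) a = ∑' i, c i * S.indicator (f i) a := by
  by_cases ha : a ∈ S
  · simp only [Set.indicator_of_mem ha]
  · simp only [Set.indicator_of_notMem ha, mul_zero, tsum_zero]

/-- **σ-additivity of the NoBLE nesting operator**: for measurable kernels `hᵢ` and constants `cᵢ ∈ [0,∞]`,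
`𝒩^{B,A′}(Σᵢ cᵢ hᵢ) = Σᵢ cᵢ 𝒩^{B,A′} hᵢ` (monotone convergence and Tonelli for the bond sum and the
expectation). [cite: FitznerVanDerHofstad2017, (3.30)–(3.33) (arXiv:1506.07977v2 pp. 26–27: "We insert … into R … and obtain")] -/
theorem nobleOp_tsum_mul (p : unitInterval) (B : Set (Sym2 (Site d))) (A' : Set (Site d)) {ι : Type*} [Countable ι]
    (c : ι → ℝ≥0∞) {h : ι → NobleKernel d} (hh : ∀ i, NobleKernelMeasurable (h i)) (A : Set (Site d)) (v x : Site d) :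
    nobleOp d p B A' (fun w A v x => ∑' i, c i * h i w A v x) A v x = ∑' i, c i * nobleOp d p B A' (h i) A v x := by
  simp only [nobleOp_apply]
  have hint : ∀ b : Site d × Site d,
      ∫⁻ ω, (nobleCell B A' A v b.1 b.2).indicator
          (fun ω => ∑' i, c i * h i b.1 (restrCluster b.1 b.2 v (offBonds B ω) ∪ A') b.2 x) ω
          ∂(bondPercolation (zdGraph d) p) =
        ∑' i, c i * ∫⁻ ω, (nobleCell B A' A v b.1 b.2).indicator
          (fun ω => h i b.1 (restrCluster b.1 b.2 v (offBonds B ω) ∪ A') b.2 x) ω ∂(bondPercolation (zdGraph d) p) := by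
    intro b
    rw [show (fun ω => (nobleCell B A' A v b.1 b.2).indicator
          (fun ω => ∑' i, c i * h i b.1 (restrCluster b.1 b.2 v (offBonds B ω) ∪ A') b.2 x) ω) =
        fun ω => ∑' i, c i * (nobleCell B A' A v b.1 b.2).indicator
          (fun ω => h i b.1 (restrCluster b.1 b.2 v (offBonds B ω) ∪ A') b.2 x) ω from
      funext fun ω => indicator_tsum_mul _ c (fun i ω => h i b.1 (restrCluster b.1 b.2 v (offBonds B ω) ∪ A') b.2 x) ω]
    rw [lintegral_tsum fun i => ((measurable_nobleIntegrand (hh i) B A' A v x b.1 b.2).const_mul (c i)).aemeasurable]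
    refine tsum_congr fun i => ?_
    rw [lintegral_const_mul _ (measurable_nobleIntegrand (hh i) B A' A v x b.1 b.2)]
  simp_rw [hint]
  calc ∑' b : Site d × Site d, ENNReal.ofReal (bondJ d p (b.2 - b.1)) *
        ∑' i, c i * ∫⁻ ω, (nobleCell B A' A v b.1 b.2).indicator
          (fun ω => h i b.1 (restrCluster b.1 b.2 v (offBonds B ω) ∪ A') b.2 x) ω ∂(bondPercolation (zdGraph d) p)
      = ∑' b : Site d × Site d, ∑' i, c i * (ENNReal.ofReal (bondJ d p (b.2 - b.1)) *
        ∫⁻ ω, (nobleCell B A' A v b.1 b.2).indicator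
          (fun ω => h i b.1 (restrCluster b.1 b.2 v (offBonds B ω) ∪ A') b.2 x) ω ∂(bondPercolation (zdGraph d) p)) := by
        refine tsum_congr fun b => ?_
        rw [← ENNReal.tsum_mul_left]
        refine tsum_congr fun i => ?_
        rw [mul_left_comm]
    _ = ∑' i, ∑' b : Site d × Site d, c i * (ENNReal.ofReal (bondJ d p (b.2 - b.1)) *
        ∫⁻ ω, (nobleCell B A' A v b.1 b.2).indicator
          (fun ω => h i b.1 (restrCluster b.1 b.2 v (offBonds B ω) ∪ A') b.2 x) ω ∂(bondPercolation (zdGraph d) p)) :=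
        ENNReal.tsum_comm
    _ = _ := tsum_congr fun i => ENNReal.tsum_mul_left

/-- A countable non-negative combination of measurable kernels is measurable. [folklore] -/
theorem nobleKernelMeasurable_tsum_mul {ι : Type*} [Countable ι] (c : ι → ℝ≥0∞) {h : ι → NobleKernel d}
    (hh : ∀ i, NobleKernelMeasurable (h i)) : NobleKernelMeasurable (fun w A v x => ∑' i, c i * h i w A v x) :=
  fun w v x => Measurable.tsum fun i => (hh i w v x).const_mul (c i)

/-- **σ-additivity of the iterated nesting operator**: `𝒩ⁿ(Σᵢ cᵢ hᵢ) = Σᵢ cᵢ 𝒩ⁿ hᵢ`.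
[cite: FitznerVanDerHofstad2017, (3.30)–(3.33) (arXiv:1506.07977v2 pp. 26–27)] -/
theorem nobleIter_tsum_mul (p : unitInterval) {ι : Type*} [Countable ι] (c : ι → ℝ≥0∞) {h : ι → NobleKernel d}
    (hh : ∀ i, NobleKernelMeasurable (h i)) :
    ∀ n, nobleIter d p (fun w A v x => ∑' i, c i * h i w A v x) n =
      fun w A v x => ∑' i, c i * nobleIter d p (h i) n w A v x
  | 0 => rfl
  | n + 1 => by
      funext w A v x
      rw [nobleIter_succ, nobleIter_tsum_mul p c hh n, nobleOpW_apply,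
        nobleOp_tsum_mul p _ _ c (fun i => nobleIter_measurable p (hh i) n)]
      simp only [nobleIter_succ, nobleOpW_apply]

/-- The nesting operator sees its last argument only through the kernel: if `h₁(·,·,·,x₁) = h₂(·,·,·,x₂)`
then `𝒩^{B,A′}h₁(A,v,x₁) = 𝒩^{B,A′}h₂(A,v,x₂)`. [cite: FitznerVanDerHofstad2017, (3.26) (arXiv:1506.07977v2 p. 26)] -/
theorem nobleOp_congr_last (p : unitInterval) (B : Set (Sym2 (Site d))) (A' : Set (Site d)) {h₁ h₂ : NobleKernel d}
    {x₁ x₂ : Site d} (hx : ∀ w A v, h₁ w A v x₁ = h₂ w A v x₂) (A : Set (Site d)) (v : Site d) :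
    nobleOp d p B A' h₁ A v x₁ = nobleOp d p B A' h₂ A v x₂ := by
  rw [nobleOp_apply, nobleOp_apply]
  refine tsum_congr fun b => ?_
  congr 1
  refine lintegral_congr fun ω => ?_
  by_cases hω : ω ∈ nobleCell B A' A v b.1 b.2
  · rw [Set.indicator_of_mem hω, Set.indicator_of_mem hω, hx]
  · rw [Set.indicator_of_notMem hω, Set.indicator_of_notMem hω]

/-- Iterated version of `nobleOp_congr_last`. [cite: FitznerVanDerHofstad2017, (3.31)–(3.33) (arXiv:1506.07977v2 p. 27)] -/
theorem nobleIter_congr_last (p : unitInterval) {h₁ h₂ : NobleKernel d} {x₁ x₂ : Site d}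
    (hx : ∀ w A v, h₁ w A v x₁ = h₂ w A v x₂) :
    ∀ n w A v, nobleIter d p h₁ n w A v x₁ = nobleIter d p h₂ n w A v x₂
  | 0 => hx
  | n + 1 => fun w A v => by
      rw [nobleIter_succ, nobleIter_succ, nobleOpW_apply, nobleOpW_apply]
      exact nobleOp_congr_last p _ _ (nobleIter_congr_last p hx n) A v

/-- `𝒩ⁿ⁺¹ h = 𝒩ⁿ(𝒩 h)`: the iterate can also be grown from the inside. [folklore] -/
theorem nobleIter_succ' (p : unitInterval) (h : NobleKernel d) :
    ∀ n, nobleIter d p h (n + 1) = nobleIter d p (nobleOpW d p h) n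
  | 0 => rfl
  | n + 1 => by rw [nobleIter_succ, nobleIter_succ' p h n, ← nobleIter_succ]

/-! ### C. The neighbour sum `Σ_{u′} J(u′-u) F(u′) = Σ_κ p F(u - e_κ)`, translation of `P^{B(u)}(u′ ↔ y)` -/

/-- The `2d` unit steps `e_κ` are pairwise distinct. [folklore] -/
theorem stepVec_injective' : Function.Injective (Percolation.stepVec : Fin d × Bool → Site d) := by
  intro a b h
  have ha := congrFun h a.1
  have hb := congrFun h b.1
  rw [stepVec_eq_single, stepVec_eq_single, Pi.single_eq_same, Pi.single_apply] at ha
  rw [stepVec_eq_single, stepVec_eq_single, Pi.single_apply, Pi.single_eq_same] at hb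
  have h1 : a.1 = b.1 := by
    by_contra hne
    rw [if_neg hne] at ha
    revert ha; cases a.2 <;> simp
  refine Prod.ext h1 ?_
  rw [if_pos h1] at ha
  revert ha; cases a.2 <;> cases b.2 <;> simp

/-- `u′ - u` is a lattice step iff `u′ = u - e_κ` for some `κ` (then `u′ - u = -e_κ = e_{-κ}`). [folklore] -/
theorem zdGraph_adj_zero_sub_iff (u u' : Site d) :
    (zdGraph d).Adj 0 (u' - u) ↔ ∃ κ : Fin d × Bool, u' = u - Percolation.stepVec κ := by
  rw [show (0 : Site d) = u - u from (sub_self u).symm, DCT16.zdGraph_adj_sub_iff, (zdGraph d).adj_comm,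
    zdGraph_adj_iff_stepVec]
  constructor
  · rintro ⟨κ, hκ⟩
    exact ⟨κ, by rw [hκ, add_sub_cancel_right]⟩
  · rintro ⟨κ, rfl⟩
    exact ⟨κ, by rw [sub_add_cancel]⟩

/-- **The bond sum as a sum over directions**: `Σ_{u′} J(u′ - u) F(u′) = Σ_κ p · F(u - e_κ)`
(`J(z) = p 𝟙{|z| = 1}`, the `2d` neighbours `u - e_κ` of `u` being distinct).
[cite: FitznerVanDerHofstad2017, (1.1) and (3.35) (arXiv:1506.07977v2 pp. 3, 27)] -/
theorem tsum_bondJ_mul (p : unitInterval) (u : Site d) (F : Site d → ℝ≥0∞) :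
    ∑' u', ENNReal.ofReal (bondJ d p (u' - u)) * F u' =
      ∑ κ : Fin d × Bool, ENNReal.ofReal p * F (u - Percolation.stepVec κ) := by
  classical
  rw [tsum_eq_sum (s := Finset.univ.image fun κ : Fin d × Bool => u - Percolation.stepVec κ)]
  · rw [Finset.sum_image fun κ _ κ' _ h => stepVec_injective' (sub_right_injective h)]
    refine Finset.sum_congr rfl fun κ _ => ?_
    rw [bondJ_def, if_pos ((zdGraph_adj_zero_sub_iff u _).2 ⟨κ, rfl⟩)]
  · intro u' hu'
    have hna : ¬ (zdGraph d).Adj 0 (u' - u) := fun h => by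
      obtain ⟨κ, rfl⟩ := (zdGraph_adj_zero_sub_iff u u').1 h
      exact hu' (Finset.mem_image.2 ⟨κ, Finset.mem_univ _, rfl⟩)
    rw [bondJ_eq_zero_of_not_adj p hna, ENNReal.ofReal_zero, zero_mul]

/-- **Translation invariance of the restricted two-point function**:
`P^{B(u)}(u′ ↔ y) = P^{B(u-u′)}(0 ↔ y-u′) = τ^{(u-u′)}(y-u′)` (shift by `-u′`).
[cite: FitznerVanDerHofstad2017, (3.5) and (3.35) (arXiv:1506.07977v2 pp. 22, 27: "P^{B(w)}(w+e_κ ↔ y) = τ^κ(y-w+e_κ)")] -/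
theorem probOff_bondsAt_openConn_shift (p : unitInterval) (u u' y : Site d) :
    probOff d p (bondsAt {u}) (openConn u' y) = probOff d p (bondsAt {u - u'}) (openConn 0 (y - u')) := by
  rw [probOff_def, probOff_def]
  have key := measure_setOf_offBonds_relabel (zdShiftIso u') p (bondsAt {u - u'})
    (P := fun ζ => ζ ∈ openConn (0 : Site d) (y - u'))
    (P' := fun ζ => ζ ∈ openConn ((zdShiftIso u').toEquiv 0) ((zdShiftIso u').toEquiv (y - u')))
    (fun ζ => relabel_mem_openConn_iff (zdShiftIso u').toEquiv ζ 0 (y - u'))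
  rw [relabel_bondsAt_singleton] at key
  have h0 : (zdShiftIso u').toEquiv (0 : Site d) = u' := by
    show zdShiftIso u' 0 = u'; rw [zdShiftIso_apply, zero_add]
  have hy : (zdShiftIso u').toEquiv (y - u') = y := by
    show zdShiftIso u' (y - u') = y; rw [zdShiftIso_apply, sub_add_cancel]
  have hu : (zdShiftIso u') (u - u') = u := by rw [zdShiftIso_apply, sub_add_cancel]
  rw [h0, hy, hu] at key
  exact key

/-- `P^{B(e)}(0 ↔ z) = τ^{e}(z)` in `[0,∞]`. [cite: FitznerVanDerHofstad2017, (3.5) (arXiv:1506.07977v2 p. 22)] -/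
theorem probOff_bondsAt_openConn_eq_ofReal_tauOff (p : unitInterval) (e z : Site d) :
    probOff d p (bondsAt {e}) (openConn 0 z) = ENNReal.ofReal (tauOff d p e z) := by
  rw [tauOff_def, ENNReal.ofReal_toReal (ne_top_of_le_ne_top ENNReal.one_ne_top (probOff_le_one p _ _))]

/-! ### D. Emptiness of degenerate cells; the innermost expectation -/

/-- In `ω_{B(w)^c}` the vertex `w` is isolated: `w ↔ x` off `B(w)` forces `x = w`. [folklore] -/
theorem eq_of_reachable_offBonds_bondsAt {ω : BondConfig (Site d)} {w x : Site d}
    (h : (openGraph (offBonds (bondsAt {w}) ω)).Reachable w x) : x = w := by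
  obtain ⟨q⟩ := h
  cases q with
  | nil => rfl
  | cons hadj _ =>
    rw [openGraph_adj, offBonds_def] at hadj
    exact absurd ((mem_bondsAt_singleton_iff w _).2 (Sym2.mem_mk_left _ _)) hadj.1.2

/-- **Degenerate cells are empty**: for outer data `(B(w), A′)` with `w ∈ A′` and a starting point `x ∉ A`,
no cell of the bond sum uses a bond containing `w` (if `u = w` then `x ↔ w` off `B(w)` forces `x = w`, and
`E′(x,x;A)` forces `x ∈ A`; if `u′ = w ∈ A′` the cut-indicator `𝟙{u′ ∉ C̃ ∪ A′}` vanishes).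
[cite: FitznerVanDerHofstad2017, (3.24)–(3.26) (arXiv:1506.07977v2 pp. 25–26)] -/
theorem nobleCell_bondsAt_eq_empty {w : Site d} {A' A : Set (Site d)} {x : Site d} (hw : w ∈ A') (hx : x ∉ A)
    {u u' : Site d} (hb : s(u, u') ∈ bondsAt {w}) : nobleCell (bondsAt {w}) A' A x u u' = ∅ := by
  rw [Set.eq_empty_iff_forall_notMem]
  intro ω hω
  rw [mem_nobleCell_iff] at hω
  rw [mem_bondsAt_singleton_iff, Sym2.mem_iff] at hb
  rcases hb with rfl | rfl
  · -- `u = w`: `x ↔ w` off `B(w)` gives `x = w`, then `E'(w,w;A)` gives `w ∈ A`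
    have hxw : x = w :=
      (eq_of_reachable_offBonds_bondsAt ((laceE_subset_openConn A x w hω.1).symm))
    subst hxw
    exact hx (mem_of_mem_laceE_self hω.1)
  · exact hω.2 (Or.inr hw)

/-- The cell of an inner level is the event of `nobleKerPsi`:
`P(cell^{(B(w′),{w′})}(A,v,u,u′)) = nobleKerPsi (u-u′) w′ A v u`. [cite: FitznerVanDerHofstad2017, (3.32) (arXiv:1506.07977v2 p. 27)] -/
theorem measure_nobleCell_inner (p : unitInterval) (w' : Site d) (A : Set (Site d)) (v u u' : Site d) :
    bondPercolation (zdGraph d) p (nobleCell (bondsAt {w'}) {w'} A v u u') = nobleKerPsi d p (u - u') w' A v u := by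
  rw [nobleKerPsi_apply, sub_sub_cancel]
  rfl

/-- For general outer data, the cell is contained in the event of `Ψ^{B,(0),κ}` as soon as its bond is
not in `B`. [cite: FitznerVanDerHofstad2017, (3.32) (arXiv:1506.07977v2 p. 27)] -/
theorem measure_nobleCell_le_noblePsiBT_zero (p : unitInterval) (B : Set (Sym2 (Site d))) (A' A : Set (Site d))
    (x u : Site d) (e : Site d) (hB : s(u, u - e) ∈ B → nobleCell B A' A x u (u - e) = ∅) :
    bondPercolation (zdGraph d) p (nobleCell B A' A x u (u - e)) ≤ noblePsiBT d p B A' e 0 A x u := by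
  by_cases hb : s(u, u - e) ∈ B
  · rw [hB hb, measure_empty]; exact zero_le
  · rw [noblePsiBT_zero]
    refine measure_mono fun ω hω => ?_
    rw [mem_nobleCell_iff] at hω
    exact ⟨hb, hω.1, fun h => hω.2 (Or.inl h)⟩

/-- **The innermost expectation, bounded by neighbour sums** (general outer data, cell form):
`𝒩^{B,A′}[P^{B(u)}(u′ ↔ y through C̃∪A′)](A,v,y) ≤ Σ_u Σ_κ p · P(cell(A,v,u,u-e_κ)) · τ^κ(y-u+e_κ)`,
by `{u′ ↔ y through C} ⊆ {u′ ↔ y}`, independence of the cell from `P^{B(u)}` (a constant), the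
translation `P^{B(u)}(u-e_κ ↔ y) = τ^{κ}(y-u+e_κ)` and `J(u′-u) = p𝟙{u′ = u - e_κ}`.
[cite: FitznerVanDerHofstad2017, (3.35) and the two lines before it (arXiv:1506.07977v2 p. 27)] -/
theorem nobleOp_nobleKerThrough_le (p : unitInterval) (B : Set (Sym2 (Site d))) (A' A : Set (Site d)) (v y : Site d) :
    nobleOp d p B A' (nobleKerThrough d p) A v y ≤
      ∑' u, ∑ κ : Fin d × Bool, ENNReal.ofReal p *
        bondPercolation (zdGraph d) p (nobleCell B A' A v u (u - Percolation.stepVec κ)) *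
          ENNReal.ofReal (tauOff d p (Percolation.stepVec κ) (y - u + Percolation.stepVec κ)) := by
  rw [nobleOp_apply, ENNReal.tsum_prod']
  refine ENNReal.tsum_le_tsum fun u => ?_
  -- freeze the inner kernel to the constant `P^{B(u)}(u' ↔ y)`
  have hstep : ∀ u', ∫⁻ ω, (nobleCell B A' A v u u').indicator
        (fun ω => nobleKerThrough d p u (restrCluster u u' v (offBonds B ω) ∪ A') u' y) ω ∂(bondPercolation (zdGraph d) p) ≤
      probOff d p (bondsAt {u - u'}) (openConn 0 (y - u')) * bondPercolation (zdGraph d) p (nobleCell B A' A v u u') := by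
    intro u'
    rw [← lintegral_indicator_const (measurableSet_nobleCell B A' A v u u')]
    refine lintegral_mono fun ω => Set.indicator_le_indicator ?_
    rw [nobleKerThrough_apply, ← probOff_bondsAt_openConn_shift]
    exact measure_mono (occursOff_mono _ (connThrough_subset_openConn _ u' y))
  calc ∑' u', ENNReal.ofReal (bondJ d p ((u, u').2 - (u, u').1)) * ∫⁻ ω, (nobleCell B A' A v (u, u').1 (u, u').2).indicator
          (fun ω => nobleKerThrough d p (u, u').1 (restrCluster (u, u').1 (u, u').2 v (offBonds B ω) ∪ A') (u, u').2 y) ω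
          ∂(bondPercolation (zdGraph d) p)
      ≤ ∑' u', ENNReal.ofReal (bondJ d p (u' - u)) *
          (probOff d p (bondsAt {u - u'}) (openConn 0 (y - u')) * bondPercolation (zdGraph d) p (nobleCell B A' A v u u')) :=
        ENNReal.tsum_le_tsum fun u' => mul_le_mul' le_rfl (hstep u')
    _ = ∑ κ : Fin d × Bool, ENNReal.ofReal p * (probOff d p (bondsAt {u - (u - Percolation.stepVec κ)})
          (openConn 0 (y - (u - Percolation.stepVec κ))) *
            bondPercolation (zdGraph d) p (nobleCell B A' A v u (u - Percolation.stepVec κ))) :=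
        tsum_bondJ_mul p u _
    _ = _ := by
        refine Finset.sum_congr rfl fun κ _ => ?_
        rw [sub_sub_cancel, show y - (u - Percolation.stepVec κ) = y - u + Percolation.stepVec κ by abel,
          probOff_bondsAt_openConn_eq_ofReal_tauOff, mul_assoc, mul_comm (ENNReal.ofReal (tauOff d p _ _))]

/-- **The innermost expectation of an inner level**:
`𝒩_{w′}[P^{B(u)}(u′ ↔ y through ·)](A,v,y) ≤ Σ_u Σ_κ p · nobleKerPsi e_κ w′ A v u · τ^κ(y-u+e_κ)`.
[cite: FitznerVanDerHofstad2017, (3.35) and the two lines before it (arXiv:1506.07977v2 p. 27)] -/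
theorem nobleOpW_nobleKerThrough_le (p : unitInterval) (w' : Site d) (A : Set (Site d)) (v y : Site d) :
    nobleOpW d p (nobleKerThrough d p) w' A v y ≤
      ∑' u, ∑ κ : Fin d × Bool, ENNReal.ofReal p * nobleKerPsi d p (Percolation.stepVec κ) w' A v u *
        ENNReal.ofReal (tauOff d p (Percolation.stepVec κ) (y - u + Percolation.stepVec κ)) := by
  rw [nobleOpW_apply]
  refine (nobleOp_nobleKerThrough_le p _ _ A v y).trans (le_of_eq ?_)
  refine tsum_congr fun u => Finset.sum_congr rfl fun κ _ => ?_
  rw [measure_nobleCell_inner, sub_sub_cancel]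

/-! ### E. The remainder bounds -/

/-- **[FvdH17, (3.35)] `Rxbd` for `N ≥ 1`, arbitrary outer data**:
`|R^B_{N+1}|(x,y;A) ≤ Σ_u Σ_κ p · Ψ^{B,(N+1),κ}(x,u;A) · τ^κ(y-u+e_κ)` — bound the innermost expectation by
neighbour sums (previous lemma), then push the sum through the `N+1` outer expectations (σ-additivity and
monotonicity of `𝒩`), recognising `Ψ^{B,(N+1),κ}`.
[cite: FitznerVanDerHofstad2017, (3.35) (arXiv:1506.07977v2 p. 27)] -/
theorem nobleRBT_succ_le (p : unitInterval) (B : Set (Sym2 (Site d))) (A' : Set (Site d)) (N : ℕ)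
    (A : Set (Site d)) (x y : Site d) :
    nobleRBT d p B A' (N + 1) A x y ≤
      ∑' u, ∑ κ : Fin d × Bool, ENNReal.ofReal p * noblePsiBT d p B A' (Percolation.stepVec κ) (N + 1) A x u *
        ENNReal.ofReal (tauOff d p (Percolation.stepVec κ) (y - u + Percolation.stepVec κ)) := by
  -- coefficients frozen at the final point `y`, kernels indexed by `(u, κ)`
  let c : Site d × (Fin d × Bool) → ℝ≥0∞ := fun i =>
    ENNReal.ofReal p * ENNReal.ofReal (tauOff d p (Percolation.stepVec i.2) (y - i.1 + Percolation.stepVec i.2))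
  let k : Site d × (Fin d × Bool) → NobleKernel d := fun i w A v _ => nobleKerPsi d p (Percolation.stepVec i.2) w A v i.1
  have hk : ∀ i, NobleKernelMeasurable (k i) := fun i w v _ => nobleKerPsi_measurable p (Percolation.stepVec i.2) w v i.1
  -- the majorising kernel with coefficients depending on the last argument
  let K : NobleKernel d := fun w A v y' => ∑' i : Site d × (Fin d × Bool),
    (ENNReal.ofReal p * ENNReal.ofReal (tauOff d p (Percolation.stepVec i.2) (y' - i.1 + Percolation.stepVec i.2))) *
      nobleKerPsi d p (Percolation.stepVec i.2) w A v i.1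
  have hK : ∀ w A v y', nobleOpW d p (nobleKerThrough d p) w A v y' ≤ K w A v y' := by
    intro w A v y'
    refine (nobleOpW_nobleKerThrough_le p w A v y').trans (le_of_eq ?_)
    show _ = ∑' i : Site d × (Fin d × Bool), _
    rw [ENNReal.tsum_prod']
    refine tsum_congr fun u => ?_
    rw [tsum_fintype]
    refine Finset.sum_congr rfl fun κ _ => ?_
    rw [mul_right_comm]
  have hKk : ∀ w A v, K w A v y = (fun w A v x' => ∑' i, c i * k i w A v x') w A v y := fun w A v => rfl
  calc nobleRBT d p B A' (N + 1) A x y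
      = nobleOp d p B A' (nobleIter d p (nobleOpW d p (nobleKerThrough d p)) N) A x y := by
        rw [nobleRBT_def, nobleIter_succ']
    _ ≤ nobleOp d p B A' (nobleIter d p K N) A x y := nobleOp_mono p B A' (nobleIter_mono p hK N) A x y
    _ = nobleOp d p B A' (nobleIter d p (fun w A v x' => ∑' i, c i * k i w A v x') N) A x y :=
        nobleOp_congr_last p B A' (nobleIter_congr_last p hKk N) A x
    _ = ∑' i, c i * nobleOp d p B A' (nobleIter d p (k i) N) A x y := by
        rw [nobleIter_tsum_mul p c hk N, nobleOp_tsum_mul p B A' c (fun i => nobleIter_measurable p (hk i) N)]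
    _ = ∑' i, c i * noblePsiBT d p B A' (Percolation.stepVec i.2) (N + 1) A x i.1 := by
        refine tsum_congr fun i => ?_
        rw [noblePsiBT_succ, nobleOp_congr_last p B A'
          (nobleIter_congr_last p (h₁ := k i) (h₂ := nobleKerPsi d p (Percolation.stepVec i.2)) (x₁ := y) (x₂ := i.1)
            (fun w A v => rfl) N) A x]
    _ = _ := by
        rw [ENNReal.tsum_prod']
        refine tsum_congr fun u => ?_
        rw [tsum_fintype]
        refine Finset.sum_congr rfl fun κ _ => ?_
        show ENNReal.ofReal p * ENNReal.ofReal _ * _ = _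
        rw [mul_right_comm]

/-- **[FvdH17, (3.35)] at `N = 0`** for outer data without degenerate cells (`hB`; automatic for `B = ∅`,
and for `(B(w), A′ ∋ w)` with `x ∉ A`): `|R^B_0|(x,y;A) ≤ Σ_u Σ_κ p · Ψ^{B,(0),κ}(x,u;A) · τ^κ(y-u+e_κ)`.
[cite: FitznerVanDerHofstad2017, (3.35) (arXiv:1506.07977v2 p. 27)] -/
theorem nobleRBT_zero_le (p : unitInterval) (B : Set (Sym2 (Site d))) (A' : Set (Site d)) (A : Set (Site d))
    (x y : Site d) (hB : ∀ u u', s(u, u') ∈ B → nobleCell B A' A x u u' = ∅) :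
    nobleRBT d p B A' 0 A x y ≤
      ∑' u, ∑ κ : Fin d × Bool, ENNReal.ofReal p * noblePsiBT d p B A' (Percolation.stepVec κ) 0 A x u *
        ENNReal.ofReal (tauOff d p (Percolation.stepVec κ) (y - u + Percolation.stepVec κ)) := by
  rw [nobleRBT_def, nobleIter_zero]
  refine (nobleOp_nobleKerThrough_le p B A' A x y).trans ?_
  refine ENNReal.tsum_le_tsum fun u => Finset.sum_le_sum fun κ _ => ?_
  exact mul_le_mul' (mul_le_mul' le_rfl (measure_nobleCell_le_noblePsiBT_zero p B A' A x u _ (hB u _))) le_rfl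

/-- **[FvdH17, (3.35)] for all `N`, outer data `(∅, A′)`**.
[cite: FitznerVanDerHofstad2017, (3.35) (arXiv:1506.07977v2 p. 27)] -/
theorem nobleRBT_empty_le (p : unitInterval) (A' : Set (Site d)) (N : ℕ) (A : Set (Site d)) (x y : Site d) :
    nobleRBT d p ∅ A' N A x y ≤
      ∑' u, ∑ κ : Fin d × Bool, ENNReal.ofReal p * noblePsiBT d p ∅ A' (Percolation.stepVec κ) N A x u *
        ENNReal.ofReal (tauOff d p (Percolation.stepVec κ) (y - u + Percolation.stepVec κ)) := by
  cases N with
  | zero => exact nobleRBT_zero_le p ∅ A' A x y fun u u' h => absurd h (Set.notMem_empty _)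
  | succ N => exact nobleRBT_succ_le p ∅ A' N A x y

/-- **[FvdH17, (3.35)] for all `N`, outer data `(B(w), A′)` with `w ∈ A′`, started outside `A`** (the data
`(B(0), {0})`, `x = e_ι ∉ C̃` of the second summand of (3.57)).
[cite: FitznerVanDerHofstad2017, (3.35) (arXiv:1506.07977v2 p. 27), (3.57) (p. 30)] -/
theorem nobleRBT_bondsAt_le (p : unitInterval) {w : Site d} {A' : Set (Site d)} (hw : w ∈ A') (N : ℕ)
    {A : Set (Site d)} {x : Site d} (hx : x ∉ A) (y : Site d) :
    nobleRBT d p (bondsAt {w}) A' N A x y ≤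
      ∑' u, ∑ κ : Fin d × Bool, ENNReal.ofReal p * noblePsiBT d p (bondsAt {w}) A' (Percolation.stepVec κ) N A x u *
        ENNReal.ofReal (tauOff d p (Percolation.stepVec κ) (y - u + Percolation.stepVec κ)) := by
  cases N with
  | zero => exact nobleRBT_zero_le p _ A' A x y fun u u' h => nobleCell_bondsAt_eq_empty hw hx h
  | succ N => exact nobleRBT_succ_le p _ A' N A x y

/-! ### F. Proposition 2.1, (2.19): `R_M(x) ≤ μ_p Σ_y Σ_κ Ψ^{(M),κ}(y) τ^κ(x - y + e_κ)` (`M ≥ 1`; arXiv v2 p. 11 = EJP p. 10) -/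

/-- **(2.19) in `[0,∞]`, printed form (with `μ_p`)**: `|R^∅_{M}|(0,x;{0}) ≤ Σ_y Σ_κ p · (μ_p/p)Ψ^{(M),κ}(y) ·
τ^κ(x-y+e_κ)` for `M ≥ 1` (`(μ_p/p)Ψ^{(M),κ} = noblePsiT`, so the summand is `μ_p Ψ^{(M),κ}(y) τ^κ(…)`).
[cite: FitznerVanDerHofstad2017, Prop. 2.1 (2.18)–(2.19) (arXiv:1506.07977v2 pp. 10–11, the displays (2.16)–(2.20) on p. 11; EJP 22 (2017) no. 43 p. 10), (3.35), (3.43)–(3.44) (pp. 27–28)] -/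
theorem nobleRBT_remainder_le_noblePsiT (p : unitInterval) (N : ℕ) (x : Site d) :
    nobleRBT d p ∅ ∅ (N + 1) {0} 0 x ≤
      ∑' y, ∑ κ : Fin d × Bool, ENNReal.ofReal p * noblePsiT d p (Percolation.stepVec κ) (N + 1) y *
        ENNReal.ofReal (tauOff d p (Percolation.stepVec κ) (x - y + Percolation.stepVec κ)) := by
  refine (nobleRBT_empty_le p ∅ (N + 1) {0} 0 x).trans (le_of_eq ?_)
  refine tsum_congr fun y => Finset.sum_congr rfl fun κ _ => ?_
  rw [noblePsiT_of_ne (Or.inl (Nat.succ_ne_zero N))]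

/-- `μ_p ≤ p` (`μ_p = p · P(e ∉ C̃^{(0,e)}(0) | (0,e) vacant)`). [cite: FitznerVanDerHofstad2017, (3.42) (arXiv:1506.07977v2 p. 28)] -/
theorem nobleMu_le_coe (p : unitInterval) : nobleMu d p ≤ (p : ℝ) := by
  unfold nobleMu
  refine (mul_le_mul_of_nonneg_left measureReal_le_one p.2.1).trans (le_of_eq (mul_one _))

/-- `μ_p ≤ 1`. [cite: FitznerVanDerHofstad2017, (3.42) (arXiv:1506.07977v2 p. 28)] -/
theorem nobleMu_le_one (p : unitInterval) : nobleMu d p ≤ 1 := (nobleMu_le_coe p).trans p.2.2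

/-- `Ψ^{(N),κ} ≥ 0`. [folklore] -/
theorem noblePsiN_nonneg' (p : unitInterval) (e : Site d) (N : ℕ) (x : Site d) : 0 ≤ noblePsiN d p e N x := by
  rw [noblePsiN_def]
  exact mul_nonneg (div_nonneg p.2.1 (nobleMu_nonneg d p)) ENNReal.toReal_nonneg

/-- `|R_M(x)| = |R^∅_M|(0,x;{0})` (the sign `(-1)^{M+1}` of (3.33) drops out).
[cite: FitznerVanDerHofstad2017, (3.33), (3.44) (arXiv:1506.07977v2 pp. 27–28)] -/
theorem abs_nobleR_eq (p : unitInterval) (M : ℕ) (x : Site d) :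
    |nobleR d p M x| = (nobleRBT d p ∅ ∅ M {0} 0 x).toReal := by
  rw [nobleR, nobleRB_def, abs_mul, abs_pow, abs_neg, abs_one, one_pow, one_mul, abs_of_nonneg ENNReal.toReal_nonneg]

section Real

variable (hd : 2 ≤ d)
include hd

/-- The majorant of (2.19) is finite below `p_c`: `Σ_y Σ_κ p (μ_p/p)Ψ^{(N),κ}(y) τ^κ(x-y+e_κ) < ∞`.
[cite: FitznerVanDerHofstad2017, (3.34)–(3.35) (arXiv:1506.07977v2 p. 27)] -/
theorem tsum_noblePsiT_tauOff_ne_top {p : unitInterval} (hp : p < criticalProbI d) (N : ℕ) (x : Site d) :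
    ∑' y, ∑ κ : Fin d × Bool, ENNReal.ofReal p * noblePsiT d p (Percolation.stepVec κ) N y *
        ENNReal.ofReal (tauOff d p (Percolation.stepVec κ) (x - y + Percolation.stepVec κ)) ≠ ∞ := by
  have hpR := coe_lt_criticalProb_of_lt hp
  refine ne_top_of_le_ne_top (ENNReal.mul_ne_top (ENNReal.natCast_ne_top (Fintype.card (Fin d × Bool)))
    (tsum_nobleMaj_sub_ne_top hd hpR N 0)) ?_
  rw [← ENNReal.tsum_mul_left]
  refine ENNReal.tsum_le_tsum fun y => ?_
  calc ∑ κ : Fin d × Bool, ENNReal.ofReal p * noblePsiT d p (Percolation.stepVec κ) N y *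
        ENNReal.ofReal (tauOff d p (Percolation.stepVec κ) (x - y + Percolation.stepVec κ))
      ≤ ∑ _κ : Fin d × Bool, nobleMaj d p N (y - 0) := Finset.sum_le_sum fun κ _ => by
        calc ENNReal.ofReal p * noblePsiT d p (Percolation.stepVec κ) N y *
              ENNReal.ofReal (tauOff d p (Percolation.stepVec κ) (x - y + Percolation.stepVec κ))
            ≤ 1 * nobleMaj d p N (y - 0) * 1 :=
              mul_le_mul' (mul_le_mul' (ofReal_coe_le_one p) (noblePsiT_le_nobleMaj le_rfl _ N y))
                (ENNReal.ofReal_le_one.2 (tauOff_le_one p _ _))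
          _ = nobleMaj d p N (y - 0) := by rw [one_mul, mul_one]
    _ = (Fintype.card (Fin d × Bool) : ℝ≥0∞) * nobleMaj d p N (y - 0) := by
        rw [Finset.sum_const, Finset.card_univ, nsmul_eq_mul]

/-- **Proposition 2.1, (2.19), AS PRINTED** (arXiv:1506.07977v2 TeX l.1237 `R_{\sss M}(x) \leq \aap \sum … \Psi^{\ssc[M],\kappa}(y)
\tau^{\kappa}(x-y+\ve[\kappa])`, `\aap = μ_p` of (2.18); arXiv v2 p. 11, identical on EJP 22 (2017) no. 43 p. 10): for `d ≥ 2`,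
`0 < p < p_c` and `M ≥ 1`, `|R_M(x)| ≤ μ_p Σ_y Σ_κ Ψ^{(M),κ}(y) τ^κ(x - y + e_κ)` (the factor `μ_p` comes from the
normalisation `Ψ^{(N),κ} = (p/μ_p)Ψ^{∅,(N),κ}(0,·;{0})` of (3.43) against the factor `p` of (3.35); `nobleMu d p` is
the printed `μ_p = p P(e₁ ∉ C(0) | (0,e₁) vacant)` of (2.18) by definition).
[cite: FitznerVanDerHofstad2017, Prop. 2.1 (2.18)–(2.19) (arXiv:1506.07977v2 pp. 10–11, the displays (2.16)–(2.20) on p. 11; EJP 22 (2017) no. 43 p. 10); (3.35), (3.43), (3.44) (pp. 27–28)] -/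
theorem abs_nobleR_le_mu {p : unitInterval} (hp0 : 0 < (p : ℝ)) (hp : p < criticalProbI d) (N : ℕ) (x : Site d) :
    |nobleR d p (N + 1) x| ≤ nobleMu d p * ∑' y, ∑ κ : Fin d × Bool,
      noblePsiN d p (Percolation.stepVec κ) (N + 1) y * tauOff d p (Percolation.stepVec κ) (x - y + Percolation.stepVec κ) := by
  have hp1 : (p : ℝ) < 1 := lt_of_lt_of_le (show (p : ℝ) < criticalProbI d from hp) (criticalProbI d).2.2
  have hμ : 0 < nobleMu d p := nobleMu_pos (by omega) hp0 hp1
  have hfin : ∀ y (κ : Fin d × Bool), ENNReal.ofReal p * noblePsiT d p (Percolation.stepVec κ) (N + 1) y *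
      ENNReal.ofReal (tauOff d p (Percolation.stepVec κ) (x - y + Percolation.stepVec κ)) ≠ ∞ := by
    intro y κ
    refine ENNReal.mul_ne_top (ENNReal.mul_ne_top ENNReal.ofReal_ne_top ?_) ENNReal.ofReal_ne_top
    rw [noblePsiT_of_ne (Or.inl (Nat.succ_ne_zero N))]
    exact noblePsiBT_ne_top hd ∅ ∅ _ _ _ _ _ hp
  rw [abs_nobleR_eq]
  calc (nobleRBT d p ∅ ∅ (N + 1) {0} 0 x).toReal
      ≤ (∑' y, ∑ κ : Fin d × Bool, ENNReal.ofReal p * noblePsiT d p (Percolation.stepVec κ) (N + 1) y *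
          ENNReal.ofReal (tauOff d p (Percolation.stepVec κ) (x - y + Percolation.stepVec κ))).toReal :=
        ENNReal.toReal_mono (tsum_noblePsiT_tauOff_ne_top hd hp (N + 1) x) (nobleRBT_remainder_le_noblePsiT p N x)
    _ = ∑' y, ∑ κ : Fin d × Bool, (ENNReal.ofReal p * noblePsiT d p (Percolation.stepVec κ) (N + 1) y *
          ENNReal.ofReal (tauOff d p (Percolation.stepVec κ) (x - y + Percolation.stepVec κ))).toReal := by
        rw [ENNReal.tsum_toReal_eq fun y => ENNReal.sum_ne_top.2 fun κ _ => hfin y κ]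
        exact tsum_congr fun y => ENNReal.toReal_sum fun κ _ => hfin y κ
    _ = ∑' y, ∑ κ : Fin d × Bool, nobleMu d p * (noblePsiN d p (Percolation.stepVec κ) (N + 1) y *
          tauOff d p (Percolation.stepVec κ) (x - y + Percolation.stepVec κ)) := by
        refine tsum_congr fun y => Finset.sum_congr rfl fun κ _ => ?_
        rw [ENNReal.toReal_mul, ENNReal.toReal_mul, ENNReal.toReal_ofReal p.2.1,
          ENNReal.toReal_ofReal (tauOff_nonneg p _ _), noblePsiN_def]
        field_simp
    _ = _ := by
        rw [← tsum_mul_left]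
        exact tsum_congr fun y => (Finset.mul_sum _ _ _).symm

/-- **(2.19) without the prefactor `μ_p`** — the display of the FIRST arXiv version (1506.07977v1 `IntroOv.tex`
l.244, label `RM-bd`), a corollary of the printed (2.19) (`abs_nobleR_le_mu`) via `μ_p ≤ 1`: for `d ≥ 2`,
`0 < p < p_c` and `M ≥ 1`, `R_M(x) ≤ |R_M(x)| ≤ Σ_y Σ_κ Ψ^{(M),κ}(y) τ^κ(x - y + e_κ)`.
[cite: FitznerVanDerHofstad2017, Prop. 2.1 (2.19) (arXiv:1506.07977v2 p. 11 = EJP p. 10, which print the stronger form with μ_p; μ_p-free form = arXiv v1 display)] -/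
theorem abs_nobleR_le {p : unitInterval} (hp0 : 0 < (p : ℝ)) (hp : p < criticalProbI d) (N : ℕ) (x : Site d) :
    |nobleR d p (N + 1) x| ≤ ∑' y, ∑ κ : Fin d × Bool,
      noblePsiN d p (Percolation.stepVec κ) (N + 1) y * tauOff d p (Percolation.stepVec κ) (x - y + Percolation.stepVec κ) := by
  refine (abs_nobleR_le_mu hd hp0 hp N x).trans ?_
  have hS : 0 ≤ ∑' y, ∑ κ : Fin d × Bool,
      noblePsiN d p (Percolation.stepVec κ) (N + 1) y * tauOff d p (Percolation.stepVec κ) (x - y + Percolation.stepVec κ) :=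
    tsum_nonneg fun y => Finset.sum_nonneg fun κ _ => mul_nonneg (noblePsiN_nonneg' p _ _ _) (tauOff_nonneg p _ _)
  calc nobleMu d p * _ ≤ 1 * _ := mul_le_mul_of_nonneg_right (nobleMu_le_one p) hS
    _ = _ := one_mul _

/-- **`|R_M(x)| ≤ Σ_κ Σ_y Ψ^{(M),κ}_p(y)`** (`τ^κ ≤ 1`): the form in which `R_M → 0` is read off the
summability of `Σ_N Σ_y Ψ^{(N),κ}(y)` (a corollary of the printed (2.19): `μ_p ≤ 1`, `τ^κ ≤ 1`). [cite: FitznerVanDerHofstad2017, Prop. 2.1 (2.19) (arXiv:1506.07977v2 p. 11 = EJP p. 10); after (3.37), pp. 27–28 ("This convergence follows from (3.35) … by showing that the remainder term R^B_N converges to zero")] -/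
theorem abs_nobleR_le_tsum_noblePsiN {p : unitInterval} (hp0 : 0 < (p : ℝ)) (hp : p < criticalProbI d) (N : ℕ)
    (x : Site d) :
    |nobleR d p (N + 1) x| ≤ ∑' y, ∑ κ : Fin d × Bool, noblePsiN d p (Percolation.stepVec κ) (N + 1) y := by
  refine (abs_nobleR_le hd hp0 hp N x).trans ?_
  have hΨ : ∀ κ : Fin d × Bool, Summable fun y => noblePsiN d p (Percolation.stepVec κ) (N + 1) y := by
    intro κ
    have := (summable_weighted_noblePsiT_toReal hd hp (Percolation.stepVec κ) (N + 1) (fun _ => 1)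
      (fun _ => by simp)).mul_left ((p : ℝ) / nobleMu d p)
    refine this.congr fun y => ?_
    rw [noblePsiN_def, one_mul]
  have h2 : Summable fun y => ∑ κ : Fin d × Bool, noblePsiN d p (Percolation.stepVec κ) (N + 1) y :=
    summable_sum fun κ _ => hΨ κ
  have hle : ∀ y, ∑ κ : Fin d × Bool, noblePsiN d p (Percolation.stepVec κ) (N + 1) y *
      tauOff d p (Percolation.stepVec κ) (x - y + Percolation.stepVec κ) ≤
      ∑ κ : Fin d × Bool, noblePsiN d p (Percolation.stepVec κ) (N + 1) y := fun y =>
    Finset.sum_le_sum fun κ _ => mul_le_of_le_one_right (noblePsiN_nonneg' p _ _ _) (tauOff_le_one p _ _)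
  have h1 : Summable fun y => ∑ κ : Fin d × Bool, noblePsiN d p (Percolation.stepVec κ) (N + 1) y *
      tauOff d p (Percolation.stepVec κ) (x - y + Percolation.stepVec κ) :=
    Summable.of_nonneg_of_le
      (fun y => Finset.sum_nonneg fun κ _ => mul_nonneg (noblePsiN_nonneg' p _ _ _) (tauOff_nonneg p _ _)) hle h2
  exact Summable.tsum_le_tsum hle h1 h2

end Real

/-! ### G. Proposition 2.1, (2.20): `R^ι_M(x) ≤ Σ_y Σ_κ Π^{(M),ι,κ}(y) τ^κ(x - y + e_κ)` (`M ≥ 1`) -/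

/-- `C ↦ Ψ^{B,(N),κ}(v,y;C)` is measurable (needed to integrate the bound against the law of `C̃^{b_ι}_0(0)`).
[cite: FitznerVanDerHofstad2017, (3.32) (arXiv:1506.07977v2 p. 27), (3.56) (p. 30)] -/
theorem noblePsiBT_measurable (p : unitInterval) (B : Set (Sym2 (Site d))) (A' : Set (Site d)) (e' : Site d) :
    ∀ (N : ℕ) (v y : Site d), Measurable fun C : Set (Site d) => noblePsiBT d p B A' e' N C v y
  | 0, v, y => by
      have h1 : MeasurableSet {q : Set (Site d) × BondConfig (Site d) | offBonds B q.2 ∈ laceE q.1 v y} :=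
        measurableSet_laceE_comp measurable_fst ((measurable_offBonds B).comp measurable_snd) v y
      have h2 : MeasurableSet {q : Set (Site d) × BondConfig (Site d) |
          y - e' ∈ restrCluster y (y - e') v (offBonds B q.2)} :=
        measurableSet_setOf.2 (measurable_set_iff.1 ((measurable_restrCluster y (y - e') v).comp
          ((measurable_offBonds B).comp measurable_snd)) (y - e'))
      have hS : MeasurableSet {q : Set (Site d) × BondConfig (Site d) | s(y, y - e') ∉ B ∧
          offBonds B q.2 ∈ laceE q.1 v y ∧ y - e' ∉ restrCluster y (y - e') v (offBonds B q.2)} := by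
        have e1 : {q : Set (Site d) × BondConfig (Site d) | s(y, y - e') ∉ B ∧
            offBonds B q.2 ∈ laceE q.1 v y ∧ y - e' ∉ restrCluster y (y - e') v (offBonds B q.2)} =
            {q | s(y, y - e') ∉ B} ∩ ({q | offBonds B q.2 ∈ laceE q.1 v y} ∩
              {q | y - e' ∈ restrCluster y (y - e') v (offBonds B q.2)}ᶜ) := by
          ext q; simp only [Set.mem_setOf_eq, Set.mem_inter_iff, Set.mem_compl_iff]
        rw [e1]
        exact (MeasurableSet.const _).inter (h1.inter h2.compl)
      exact measurable_measure_prodMk_left hS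
  | N + 1, v, y => nobleOp_measurable p B A' (nobleIter_measurable p (nobleKerPsi_measurable p e') N) v y

/-- `C ↦ Ξ^{B,(N)}(v,y;C)` is measurable. [cite: FitznerVanDerHofstad2017, (3.31) (arXiv:1506.07977v2 p. 27), (3.55) (p. 30)] -/
theorem nobleXiBT_measurable (p : unitInterval) (B : Set (Sym2 (Site d))) (A' : Set (Site d)) :
    ∀ (N : ℕ) (v y : Site d), Measurable fun C : Set (Site d) => nobleXiBT d p B A' N C v y
  | 0, v, y => measurable_measure_prodMk_left
      (measurableSet_laceE_comp measurable_fst ((measurable_offBonds B).comp measurable_snd) v y)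
  | N + 1, v, y => nobleOp_measurable p B A' (nobleIter_measurable p (nobleKerXi_measurable p) N) v y

/-- `C ↦ |R^B_N|(v,y;C)` is measurable. [cite: FitznerVanDerHofstad2017, (3.33) (arXiv:1506.07977v2 p. 27), (3.57) (p. 30)] -/
theorem nobleRBT_measurable (p : unitInterval) (B : Set (Sym2 (Site d))) (A' : Set (Site d)) (N : ℕ) (v y : Site d) :
    Measurable fun C : Set (Site d) => nobleRBT d p B A' N C v y :=
  nobleOp_measurable p B A' (nobleIter_measurable p (nobleKerThrough_measurable p) N) v y

/-- The event `{e_ι ∉ C̃^{b_ι}_0(0)}` of the correction term is measurable.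
[cite: FitznerVanDerHofstad2017, (3.55)–(3.57) (arXiv:1506.07977v2 p. 30)] -/
theorem measurableSet_notMem_restrCluster (e : Site d) :
    MeasurableSet {ω : BondConfig (Site d) | e ∉ restrCluster 0 e 0 (offBonds {s(0, e)} ω)} := by
  have h : {ω : BondConfig (Site d) | e ∉ restrCluster 0 e 0 (offBonds {s(0, e)} ω)} =
      {ω | e ∈ restrCluster 0 e 0 (offBonds {s(0, e)} ω)}ᶜ := by
    ext ω; simp only [Set.mem_setOf_eq, Set.mem_compl_iff]
  rw [h]
  exact (measurableSet_setOf.2 (measurable_set_iff.1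
    ((measurable_restrCluster 0 e 0).comp (measurable_offBonds {s(0, e)})) e)).compl

/-- The correction functional `G ↦ 𝔼_0^{b_ι}[𝟙{e_ι ∉ C̃} G(C̃)]` is monotone in `G` on the sets not
containing `e_ι`. [cite: FitznerVanDerHofstad2017, (3.55)–(3.57) (arXiv:1506.07977v2 p. 30)] -/
theorem nobleIotaCorr_mono_of_notMem (p : unitInterval) {e : Site d} {G₁ G₂ : Set (Site d) → ℝ≥0∞}
    (h : ∀ C, e ∉ C → G₁ C ≤ G₂ C) : nobleIotaCorr d p e G₁ ≤ nobleIotaCorr d p e G₂ := by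
  unfold nobleIotaCorr
  refine lintegral_mono fun ω => ?_
  by_cases hω : ω ∈ {ω : BondConfig (Site d) | e ∉ restrCluster 0 e 0 (offBonds {s(0, e)} ω)}
  · rw [Set.indicator_of_mem hω, Set.indicator_of_mem hω]; exact h _ hω
  · rw [Set.indicator_of_notMem hω, Set.indicator_of_notMem hω]

/-- **σ-additivity of the correction functional**: `𝔼_0^{b_ι}[𝟙{e_ι ∉ C̃} Σᵢ cᵢ Gᵢ(C̃)] = Σᵢ cᵢ 𝔼_0^{b_ι}[𝟙{e_ι ∉ C̃} Gᵢ(C̃)]`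
for measurable `Gᵢ`. [cite: FitznerVanDerHofstad2017, (3.55)–(3.57) (arXiv:1506.07977v2 p. 30)] -/
theorem nobleIotaCorr_tsum_mul (p : unitInterval) (e : Site d) {ι : Type*} [Countable ι] (c : ι → ℝ≥0∞)
    {G : ι → Set (Site d) → ℝ≥0∞} (hG : ∀ i, Measurable (G i)) :
    nobleIotaCorr d p e (fun C => ∑' i, c i * G i C) = ∑' i, c i * nobleIotaCorr d p e (G i) := by
  unfold nobleIotaCorr
  have hS := measurableSet_notMem_restrCluster (d := d) e
  have hm : ∀ i, Measurable fun ω : BondConfig (Site d) =>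
      {ω : BondConfig (Site d) | e ∉ restrCluster 0 e 0 (offBonds {s(0, e)} ω)}.indicator
        (fun ω => G i (restrCluster 0 e 0 (offBonds {s(0, e)} ω))) ω := fun i =>
    ((hG i).comp ((measurable_restrCluster 0 e 0).comp (measurable_offBonds {s(0, e)}))).indicator hS
  rw [show (fun ω => {ω : BondConfig (Site d) | e ∉ restrCluster 0 e 0 (offBonds {s(0, e)} ω)}.indicator
        (fun ω => ∑' i, c i * G i (restrCluster 0 e 0 (offBonds {s(0, e)} ω))) ω) =
      fun ω => ∑' i, c i * {ω : BondConfig (Site d) | e ∉ restrCluster 0 e 0 (offBonds {s(0, e)} ω)}.indicator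
        (fun ω => G i (restrCluster 0 e 0 (offBonds {s(0, e)} ω))) ω from
    funext fun ω => indicator_tsum_mul _ c (fun i ω => G i (restrCluster 0 e 0 (offBonds {s(0, e)} ω))) ω]
  rw [lintegral_tsum fun i => ((hm i).const_mul (c i)).aemeasurable]
  exact tsum_congr fun i => lintegral_const_mul _ (hm i)

/-- **(2.20) in `[0,∞]`** for `M ≥ 1`: `nobleRIotaT (M+1) x ≤ Σ_y Σ_κ Π^{(M+1),ι,κ}(y) τ^κ(x-y+e_κ)` — (3.35)
for `R^{b_ι}_{M+1}(0,x;{e_ι})` (outer data `({b_ι}, ∅)`) plus `p ×` (3.35) for `R^{B(0)}_M(e_ι,x;C̃)`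
(outer data `(B(0),{0})`, `e_ι ∉ C̃`) integrated against `𝔼_0^{b_ι}[𝟙{e_ι ∉ C̃} ·]`, recognising (3.56).
[cite: FitznerVanDerHofstad2017, Prop. 2.1 (2.20) (arXiv:1506.07977v2 p. 11 = EJP p. 10); (3.35) (p. 27); (3.56)–(3.57) (p. 30)] -/
theorem nobleRIotaT_succ_le (p : unitInterval) (e : Site d) (M : ℕ) (x : Site d) :
    nobleRIotaT d p e (M + 1) x ≤
      ∑' y, ∑ κ : Fin d × Bool, noblePiT d p e (Percolation.stepVec κ) (M + 1) y *
        ENNReal.ofReal (tauOff d p (Percolation.stepVec κ) (x - y + Percolation.stepVec κ)) := by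
  have h1 := nobleRBT_succ_le p {s(0, e)} ∅ M {e} 0 x
  have h2 : nobleIotaCorr d p e (fun C => nobleRBT d p (bondsAt {0}) {0} M C e x) ≤
      ∑' y, ∑ κ : Fin d × Bool, ENNReal.ofReal p *
        nobleIotaCorr d p e (fun C => noblePsiBT d p (bondsAt {0}) {0} (Percolation.stepVec κ) M C e y) *
          ENNReal.ofReal (tauOff d p (Percolation.stepVec κ) (x - y + Percolation.stepVec κ)) := by
    let c : Site d × (Fin d × Bool) → ℝ≥0∞ := fun i =>
      ENNReal.ofReal p * ENNReal.ofReal (tauOff d p (Percolation.stepVec i.2) (x - i.1 + Percolation.stepVec i.2))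
    let G : Site d × (Fin d × Bool) → Set (Site d) → ℝ≥0∞ := fun i C =>
      noblePsiBT d p (bondsAt {0}) {0} (Percolation.stepVec i.2) M C e i.1
    have hG : ∀ i, Measurable (G i) := fun i => noblePsiBT_measurable p _ _ _ M e i.1
    calc nobleIotaCorr d p e (fun C => nobleRBT d p (bondsAt {0}) {0} M C e x)
        ≤ nobleIotaCorr d p e (fun C => ∑' i, c i * G i C) := by
          refine nobleIotaCorr_mono_of_notMem p fun C hC => ?_
          refine (nobleRBT_bondsAt_le p (Set.mem_singleton (0 : Site d)) M hC x).trans (le_of_eq ?_)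
          rw [ENNReal.tsum_prod']
          refine tsum_congr fun y => ?_
          rw [tsum_fintype]
          refine Finset.sum_congr rfl fun κ _ => ?_
          show _ = ENNReal.ofReal p * ENNReal.ofReal _ * _
          rw [mul_right_comm]
      _ = ∑' i, c i * nobleIotaCorr d p e (G i) := nobleIotaCorr_tsum_mul p e c hG
      _ = _ := by
          rw [ENNReal.tsum_prod']
          refine tsum_congr fun y => ?_
          rw [tsum_fintype]
          refine Finset.sum_congr rfl fun κ _ => ?_
          show ENNReal.ofReal p * ENNReal.ofReal _ * _ = _
          rw [mul_right_comm]
  calc nobleRIotaT d p e (M + 1) x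
      = nobleRBT d p {s(0, e)} ∅ (M + 1) {e} 0 x +
          ENNReal.ofReal p * nobleIotaCorr d p e (fun C => nobleRBT d p (bondsAt {0}) {0} M C e x) := rfl
    _ ≤ (∑' y, ∑ κ : Fin d × Bool, ENNReal.ofReal p * noblePsiBT d p {s(0, e)} ∅ (Percolation.stepVec κ) (M + 1) {e} 0 y *
            ENNReal.ofReal (tauOff d p (Percolation.stepVec κ) (x - y + Percolation.stepVec κ))) +
          ENNReal.ofReal p * ∑' y, ∑ κ : Fin d × Bool, ENNReal.ofReal p *
            nobleIotaCorr d p e (fun C => noblePsiBT d p (bondsAt {0}) {0} (Percolation.stepVec κ) M C e y) *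
              ENNReal.ofReal (tauOff d p (Percolation.stepVec κ) (x - y + Percolation.stepVec κ)) :=
        add_le_add h1 (mul_le_mul' le_rfl h2)
    _ = _ := by
        rw [← ENNReal.tsum_mul_left, ← ENNReal.tsum_add]
        refine tsum_congr fun y => ?_
        rw [Finset.mul_sum, ← Finset.sum_add_distrib]
        refine Finset.sum_congr rfl fun κ _ => ?_
        show _ = (ENNReal.ofReal p * noblePsiBT d p {s(0, e)} ∅ (Percolation.stepVec κ) (M + 1) {e} 0 y +
          ENNReal.ofReal p ^ 2 * nobleIotaCorr d p e
            (fun C => noblePsiBT d p (bondsAt {0}) {0} (Percolation.stepVec κ) M C e y)) * _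
        ring

/-- `|R^ι_M(x)| = nobleRIotaT M x` below `p_c` (both summands finite).
[cite: FitznerVanDerHofstad2017, (3.54), (3.57) (arXiv:1506.07977v2 pp. 29–30); (3.34)–(3.35) (p. 27)] -/
theorem abs_nobleRIota_eq (hd : 2 ≤ d) {p : unitInterval} (hp : p < criticalProbI d) (e : Site d) (M : ℕ) (x : Site d) :
    |nobleRIota d p e M x| = (nobleRIotaT d p e M x).toReal := by
  rw [nobleRIota_eq p e M x (nobleRBT_ne_top hd _ _ M _ _ _ hp) fun M' _ =>
      nobleIotaCorr_ne_top_of_le (nobleLevelBound_ne_top p (M' + 1))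
        fun C => nobleRBT_le_bound hd le_rfl (coe_lt_criticalProb_of_lt hp) _ _ M' C e x,
    abs_mul, abs_pow, abs_neg, abs_one, one_pow, one_mul, abs_of_nonneg ENNReal.toReal_nonneg]

section RealIota

variable (hd : 2 ≤ d)
include hd

/-- The majorant of (2.20) is finite below `p_c`. [cite: FitznerVanDerHofstad2017, (3.34)–(3.35) (arXiv:1506.07977v2 p. 27)] -/
theorem tsum_noblePiT_tauOff_ne_top {p : unitInterval} (hp : p < criticalProbI d) (e : Site d) (N : ℕ) (x : Site d) :
    ∑' y, ∑ κ : Fin d × Bool, noblePiT d p e (Percolation.stepVec κ) N y *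
        ENNReal.ofReal (tauOff d p (Percolation.stepVec κ) (x - y + Percolation.stepVec κ)) ≠ ∞ := by
  have hpR := coe_lt_criticalProb_of_lt hp
  have hU : ∑' y, (nobleMaj d p N (y - 0) + nobleMaj d p (N - 1) (y - e)) ≠ ∞ := by
    rw [ENNReal.tsum_add]
    exact ENNReal.add_ne_top.2 ⟨tsum_nobleMaj_sub_ne_top hd hpR N 0, tsum_nobleMaj_sub_ne_top hd hpR (N - 1) e⟩
  refine ne_top_of_le_ne_top (ENNReal.mul_ne_top (ENNReal.natCast_ne_top (Fintype.card (Fin d × Bool))) hU) ?_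
  rw [← ENNReal.tsum_mul_left]
  refine ENNReal.tsum_le_tsum fun y => ?_
  calc ∑ κ : Fin d × Bool, noblePiT d p e (Percolation.stepVec κ) N y *
        ENNReal.ofReal (tauOff d p (Percolation.stepVec κ) (x - y + Percolation.stepVec κ))
      ≤ ∑ _κ : Fin d × Bool, (nobleMaj d p N (y - 0) + nobleMaj d p (N - 1) (y - e)) :=
        Finset.sum_le_sum fun κ _ => by
          calc noblePiT d p e (Percolation.stepVec κ) N y *
                ENNReal.ofReal (tauOff d p (Percolation.stepVec κ) (x - y + Percolation.stepVec κ))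
              ≤ (nobleMaj d p N (y - 0) + nobleMaj d p (N - 1) (y - e)) * 1 :=
                mul_le_mul' (noblePiT_le_nobleMaj le_rfl e _ N y) (ENNReal.ofReal_le_one.2 (tauOff_le_one p _ _))
            _ = _ := mul_one _
    _ = (Fintype.card (Fin d × Bool) : ℝ≥0∞) * (nobleMaj d p N (y - 0) + nobleMaj d p (N - 1) (y - e)) := by
        rw [Finset.sum_const, Finset.card_univ, nsmul_eq_mul]

/-- **Proposition 2.1, (2.20)**: for `d ≥ 2`, `p < p_c` and `M ≥ 1`,
`R^ι_M(x) ≤ |R^ι_M(x)| ≤ Σ_y Σ_κ Π^{(M),ι,κ}(y) τ^κ(x - y + e_κ)`.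
[cite: FitznerVanDerHofstad2017, Prop. 2.1 (2.20) (arXiv:1506.07977v2 p. 11 = EJP p. 10); (3.35) (p. 27); (3.56)–(3.57) (p. 30)] -/
theorem abs_nobleRIota_le {p : unitInterval} (hp : p < criticalProbI d) (e : Site d) (M : ℕ) (x : Site d) :
    |nobleRIota d p e (M + 1) x| ≤ ∑' y, ∑ κ : Fin d × Bool,
      noblePiN d p e (Percolation.stepVec κ) (M + 1) y * tauOff d p (Percolation.stepVec κ) (x - y + Percolation.stepVec κ) := by
  have hpR := coe_lt_criticalProb_of_lt hp
  have hfin : ∀ y (κ : Fin d × Bool), noblePiT d p e (Percolation.stepVec κ) (M + 1) y *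
      ENNReal.ofReal (tauOff d p (Percolation.stepVec κ) (x - y + Percolation.stepVec κ)) ≠ ∞ := fun y κ =>
    ENNReal.mul_ne_top (ne_top_of_le_ne_top
      (ENNReal.add_ne_top.2 ⟨nobleMaj_ne_top hd hpR _ _, nobleMaj_ne_top hd hpR _ _⟩)
      (noblePiT_le_nobleMaj le_rfl e _ (M + 1) y)) ENNReal.ofReal_ne_top
  rw [abs_nobleRIota_eq hd hp]
  calc (nobleRIotaT d p e (M + 1) x).toReal
      ≤ (∑' y, ∑ κ : Fin d × Bool, noblePiT d p e (Percolation.stepVec κ) (M + 1) y *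
          ENNReal.ofReal (tauOff d p (Percolation.stepVec κ) (x - y + Percolation.stepVec κ))).toReal :=
        ENNReal.toReal_mono (tsum_noblePiT_tauOff_ne_top hd hp e (M + 1) x) (nobleRIotaT_succ_le p e M x)
    _ = ∑' y, ∑ κ : Fin d × Bool, (noblePiT d p e (Percolation.stepVec κ) (M + 1) y *
          ENNReal.ofReal (tauOff d p (Percolation.stepVec κ) (x - y + Percolation.stepVec κ))).toReal := by
        rw [ENNReal.tsum_toReal_eq fun y => ENNReal.sum_ne_top.2 fun κ _ => hfin y κ]
        exact tsum_congr fun y => ENNReal.toReal_sum fun κ _ => hfin y κ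
    _ = _ := by
        refine tsum_congr fun y => Finset.sum_congr rfl fun κ _ => ?_
        rw [ENNReal.toReal_mul, ENNReal.toReal_ofReal (tauOff_nonneg p _ _), noblePiN]

/-- **`|R^ι_M(x)| ≤ Σ_κ Σ_y Π^{(M),ι,κ}_p(y)`** (`τ^κ ≤ 1`): the form in which `R^ι_M → 0` is read off the
summability of `Σ_N Σ_y Π^{(N),ι,κ}(y)`. [cite: FitznerVanDerHofstad2017, Prop. 2.1 (2.20) (arXiv:1506.07977v2 p. 11 = EJP p. 10); after (3.37), pp. 27–28] -/
theorem abs_nobleRIota_le_tsum_noblePiN {p : unitInterval} (hp : p < criticalProbI d) (e : Site d) (M : ℕ) (x : Site d) :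
    |nobleRIota d p e (M + 1) x| ≤ ∑' y, ∑ κ : Fin d × Bool, noblePiN d p e (Percolation.stepVec κ) (M + 1) y := by
  refine (abs_nobleRIota_le hd hp e M x).trans ?_
  have h2 : Summable fun y => ∑ κ : Fin d × Bool, noblePiN d p e (Percolation.stepVec κ) (M + 1) y :=
    summable_sum fun κ _ => by
      simpa only [one_mul] using summable_weighted_noblePiN hd hp e (Percolation.stepVec κ) (M + 1) (fun _ => 1)
        (fun _ => by simp)
  have hle : ∀ y, ∑ κ : Fin d × Bool, noblePiN d p e (Percolation.stepVec κ) (M + 1) y *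
      tauOff d p (Percolation.stepVec κ) (x - y + Percolation.stepVec κ) ≤
      ∑ κ : Fin d × Bool, noblePiN d p e (Percolation.stepVec κ) (M + 1) y := fun y =>
    Finset.sum_le_sum fun κ _ => mul_le_of_le_one_right (noblePiN_nonneg p _ _ _ _) (tauOff_le_one p _ _)
  have h1 : Summable fun y => ∑ κ : Fin d × Bool, noblePiN d p e (Percolation.stepVec κ) (M + 1) y *
      tauOff d p (Percolation.stepVec κ) (x - y + Percolation.stepVec κ) :=
    Summable.of_nonneg_of_le
      (fun y => Finset.sum_nonneg fun κ _ => mul_nonneg (noblePiN_nonneg p _ _ _ _) (tauOff_nonneg p _ _)) hle h2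
  exact Summable.tsum_le_tsum hle h1 h2

end RealIota

end Literature.Probability.FitznerVanDerHofstad2017

end
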